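import Mathlib.Data.Finset.NoncommProd
import Mathlib.Algebra.Polynomial.AlgebraMap
import Mathlib.Algebra.Module.LinearMap.End
import Mathlib.Tactic.NoncommRing
import HarnessLib

/-!
# Kolyvagin's derivative operators: the telescoping identity and the invariance of the
# derivative of an Euler family (pure algebra)
# (cell `b2b-bsdres`, team n1011, seat p11 GEN 7, OWNERS row T-DER = skel/T-DER.md; file F1)

HONEST FRAMING (cell `b2b-bsdres`, run/shared/lean/b2b/bsd-rank1-residual/, verbatim in every
file): the goal of the cell is to DELETE the COMBINATION-SHAPED residual classes of the
Birch–Swinnerton-Dyer formula for ALL analytic-rank `≤ 1` elliptic curves over `ℚ` — "full BSD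
formula for every rank `≤ 1` curve in class `C`" assembled STRICTLY from published theorems — so
that the rank-`≤ 1` remainder becomes exactly the CONSTRUCTION-SHAPED classes, which are TYPED
(missing-input `Prop`s), NOT attempted. This is not "finishing BSD". Team n1011 (N10 / N11, the
additive block X4 ∧ `p = 3`): research route on the CONSTRUCTION-SHAPED class X4; no claim beyond the
stated classes; nothing is booked. TOOL theorems of pure algebra (no definition, no named fact, no
`sorry`); nothing specific to elliptic curves or to Galois cohomology.

## Why (row T-DER: Euler systems → Kolyvagin systems, [Rubin00] §4.4 / [MR04] Thm. 3.2.4)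

The tree has the Euler-system object (`Literature.…GaloisRepresentations.EulerSystem`:
`IsEulerSystem L T p c`, with the one-step norm relations `Cor c_{F(rq)} = P(Fr_q⁻¹ | T*; Fr_q⁻¹) c_{F(r)}`)
and the Kolyvagin-system object (`Literature.…GaloisCohomology.KolyvaginSystems`:
`KolyvaginDatum.kolyvaginSystems`), but not the map between them: Kolyvagin's derivative
construction.  This file is its ALGEBRAIC core, for an abstract family in a module.

Let `X` be an `A`-module carrying pairwise commuting endomorphisms `σ_ℓ` (in the application:
`X = H¹(K(r), T/M)`, `σ_ℓ` = a generator of `Gal(K(ℓ)/K)` acting by conjugation), integers `N_ℓ`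
(`= [K(ℓ):K]`), endomorphisms `F_ℓ` (`= Fr_ℓ⁻¹`) and polynomials `P_ℓ ∈ A[X]` (the Euler factors).
Kolyvagin's derivative operator is `D_ℓ = Σ_{i<N_ℓ} i σ_ℓ^i`, with the **telescoping identity**
`(σ_ℓ − 1) D_ℓ = (N_ℓ − 1) σ_ℓ^{N_ℓ} + 1 − N_{σ_ℓ}`, `N_{σ_ℓ} = Σ_{i<N_ℓ} σ_ℓ^i`
([Rubin00] (4.3) / eq. before Lemma 4.4.2: "`(σ_ℓ - 1) D_ℓ = [K(ℓ):K] - N_ℓ` in `ℤ[G_ℓ]`"), and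
`D_r = ∏_{ℓ ∈ r} D_ℓ`.  An **Euler family** is `x_s ∈ X` (`s ⊆ r`) with `σ_ℓ x_s = x_s` for
`ℓ ∉ s`, `σ_ℓ^{N_ℓ} x_s = x_s` and the NORM RELATIONS `N_{σ_ℓ} x_s = P_ℓ(F_ℓ) x_{s ∖ ℓ}` for `ℓ ∈ s`
(these are `res ∘ cor` applied to the Euler-system axiom).  If `X` is killed by every `N_ℓ` and
every `P_ℓ(1)` (`ℓ ∈ r`: "`r` is a product of primes in `𝒫_M`" — `M ∣ ℓ - 1`, `M ∣ P_ℓ(1)`, and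
`M X = 0`), and each `F_ℓ` fixes every common fixed vector of the `σ`'s (`Fr_ℓ⁻¹ ∈ Gal(K(r)/K)`
is a word in the generators), then **`D_r x_r` is fixed by every `σ_ℓ`** — Rubin's Lemma 4.4.2:
"`D_r c_{F(r)} ∈ H¹(F(r), W_M)^{G_r}`", proved by his induction
`(σ_ℓ − 1) D_r x_r = −P_ℓ(Fr_ℓ⁻¹) D_{r/ℓ} x_{r/ℓ} ≡ −P_ℓ(1) D_{r/ℓ} x_{r/ℓ} ≡ 0`.

## Contents (namespace `…GaloisImage.Derivative`)

* §1 the telescoping identity in any ring (`sub_one_mul_deriv_eq`) and its module form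
  under `σ^N y = y` (`sub_one_deriv_apply_of_pow_apply_eq`); `P(F) y = P(1) • y` when `F y = y`
  (`aeval_apply_eq_eval_one_smul_of_apply_eq`).
* §1b transport of `F^i`, `Σ F^i`, `Σ i F^i`, `P(F)` along a linear map `f` with `f ∘ F = F' ∘ f`
  (`apply_pow_apply_eq_of_comm`, `apply_norm_apply_eq_of_comm`, `apply_deriv_apply_eq_of_comm`,
  `apply_aeval_apply_eq_of_comm`) — used to push the norm relations along restriction and
  reduction maps.
* §2 the invariance theorem for an abstract product operator `Dr : Finset ι → Module.End A X`
  satisfying `Dr (insert ℓ s) = D_ℓ * Dr s` (`apply_deriv_apply_eq_of_eulerFamily`), and its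
  instance for `Dr s = s.noncommProd D_•` (`apply_noncommProd_deriv_apply_eq_of_eulerFamily`).

References (context only; the statements here are elementary algebra): K. Rubin, *Euler Systems*,
Annals of Math. Studies 147 (2000), Ch. IV §4.4, Def. 4.4.1, Lemma 4.4.2; B. Mazur, K. Rubin,
*Kolyvagin systems*, Mem. AMS 799 (2004), App. A, eq. (32); K. Rubin, *Euler systems and modular
elliptic curves* / Cetraro notes in *Arithmetic theory of elliptic curves*, LNM 1716 (1999), §8.2
"Kolyvagin's derivative construction"; V. A. Kolyvagin, *Euler systems*, Grothendieck Festschrift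
II (1990).
-/

noncomputable section

open Finset Polynomial

universe u v w

namespace Summit.BirchSwinnertonDyer.Rank1Residual.GaloisImage

namespace Derivative

/-! ### §1 The telescoping identity -/

section Ring

variable {B : Type u} [Ring B]

/-- **Kolyvagin's telescoping identity** in any (not necessarily commutative) ring: with
`D = Σ_{i<N} i σ^i` and `N_σ = Σ_{i<N} σ^i`, `(σ − 1) D = (N − 1) σ^N + 1 − N_σ`, with NO
hypothesis on `σ`.  (When `σ^N = 1` this reads `(σ − 1) D = N − N_σ`, Rubin's
"(σ_ℓ − 1) D_ℓ = [K(ℓ):K] − N_ℓ"; the tree's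
`Literature.NumberTheory.EllipticCurves.KolyvaginDerivative.sub_one_mul_kolyvaginDerivative`
(Gross 1991 (3.5), Heegner side) is that case in a COMMUTATIVE ring — here the operators live in
the noncommutative ring `End_A H¹` and `σ^N = 1` holds only on the relevant classes, whence this
form.)  Ref: Rubin, *Euler Systems* (2000), §4.4 (display before Lemma 4.4.2). [folklore] -/
theorem sub_one_mul_deriv_eq (σ : B) (N : ℕ) :
    (σ - 1) * ∑ i ∈ range N, (i : B) * σ ^ i =
      ((N : B) - 1) * σ ^ N + 1 - ∑ i ∈ range N, σ ^ i := by
  induction N with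
  | zero => simp
  | succ N ih =>
    rw [sum_range_succ, sum_range_succ, mul_add, ih, Nat.cast_succ, pow_succ']
    have e : (σ - 1) * ((N : B) * σ ^ N) = (N : B) * (σ * σ ^ N) - (N : B) * σ ^ N := by
      rw [sub_mul, one_mul, ← mul_assoc, ← (Nat.cast_commute N σ).eq, mul_assoc]
    rw [e]
    noncomm_ring

end Ring

section Module

variable {A : Type u} [CommRing A] {X : Type v} [AddCommGroup X] [Module A X]

/-- The telescoping identity in `Module.End A X`, applied to a vector `y` with `σ^N y = y`:
`(σ − 1) (D y) = N • y − N_σ y`.  Ref: Rubin, *Euler Systems* (2000), §4.4. [folklore] -/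
theorem sub_one_deriv_apply_of_pow_apply_eq (σ : Module.End A X) (N : ℕ) (y : X)
    (hy : (σ ^ N) y = y) :
    (σ - 1) ((∑ i ∈ range N, (i : Module.End A X) * σ ^ i) y) =
      (N : A) • y - (∑ i ∈ range N, σ ^ i) y := by
  have h := congrArg (fun f : Module.End A X => f y) (sub_one_mul_deriv_eq σ N)
  simp only [Module.End.mul_apply, LinearMap.sub_apply, LinearMap.add_apply,
    Module.End.one_apply] at h
  have hN : ((N : Module.End A X)) y = (N : A) • y := by
    rw [Module.End.natCast_apply, Nat.cast_smul_eq_nsmul]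
  rw [LinearMap.sub_apply, Module.End.one_apply, h, hy, hN]
  abel

/-- If `F y = y` then `P(F) y = P(1) • y` for every polynomial `P`. [folklore] -/
theorem aeval_apply_eq_eval_one_smul_of_apply_eq (F : Module.End A X) (P : A[X]) (y : X)
    (hy : F y = y) : aeval F P y = (P.eval 1) • y := by
  have hpow : ∀ n : ℕ, (F ^ n) y = y := fun n => by
    induction n with
    | zero => rfl
    | succ n ih => rw [pow_succ, Module.End.mul_apply, hy, ih]
  rw [aeval_eq_sum_range, eval_eq_sum_range, LinearMap.sum_apply, sum_smul]
  refine sum_congr rfl fun n _ => ?_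
  rw [LinearMap.smul_apply, hpow, one_pow, mul_one]

/-- Commuting endomorphisms commute pointwise: `τ (g y) = g (τ y)`. [folklore] -/
theorem apply_comm_of_commute {τ g : Module.End A X} (h : Commute τ g) (y : X) :
    τ (g y) = g (τ y) := by
  have := congrArg (fun f : Module.End A X => f y) h.eq
  simpa only [Module.End.mul_apply] using this

/-- A commuting endomorphism fixes `g y` when it fixes `y`: if `Commute τ g` and `τ y = y` then
`τ (g y) = g y`. [folklore] -/
theorem apply_apply_eq_of_commute {τ g : Module.End A X} (h : Commute τ g) {y : X} (hy : τ y = y) :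
    τ (g y) = g y := by
  rw [apply_comm_of_commute h, hy]

/-- `Σ_{i<N} i σ^i` commutes with everything commuting with `σ`. [folklore] -/
theorem commute_deriv_of_commute {τ σ : Module.End A X} (h : Commute τ σ) (N : ℕ) :
    Commute τ (∑ i ∈ range N, (i : Module.End A X) * σ ^ i) :=
  Commute.sum_right _ _ _ fun i _ => ((Nat.commute_cast τ i).mul_right (h.pow_right i))

/-- `Σ_{i<N} σ^i` commutes with everything commuting with `σ`. [folklore] -/
theorem commute_norm_of_commute {τ σ : Module.End A X} (h : Commute τ σ) (N : ℕ) :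
    Commute τ (∑ i ∈ range N, σ ^ i) :=
  Commute.sum_right _ _ _ fun i _ => h.pow_right i

/-- `P(F)` commutes with everything commuting with `F`. [folklore] -/
theorem commute_aeval_of_commute {τ F : Module.End A X} (h : Commute τ F) (P : A[X]) :
    Commute τ (aeval F P) := by
  rw [aeval_eq_sum_range]
  exact Commute.sum_right _ _ _ fun i _ => (h.pow_right i).smul_right _

/-! ### §1b Transport of the operators along an intertwining linear map
(used to push the norm relations along restriction / reduction maps) -/

section Transport

variable {Y : Type w} [AddCommGroup Y] [Module A Y]

/-- If `f ∘ F = F' ∘ f` then `f ∘ F^i = F'^i ∘ f`. [folklore] -/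
theorem apply_pow_apply_eq_of_comm (f : X →ₗ[A] Y) {F : Module.End A X} {F' : Module.End A Y}
    (h : ∀ v, f (F v) = F' (f v)) (i : ℕ) (v : X) : f ((F ^ i) v) = (F' ^ i) (f v) := by
  induction i generalizing v with
  | zero => rfl
  | succ i ih => rw [pow_succ, pow_succ, Module.End.mul_apply, Module.End.mul_apply, ih, h]

/-- If `f ∘ F = F' ∘ f` then `f` carries the norm operator `Σ_{i<N} F^i` to `Σ_{i<N} F'^i`.
[folklore] -/
theorem apply_norm_apply_eq_of_comm (f : X →ₗ[A] Y) {F : Module.End A X} {F' : Module.End A Y}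
    (h : ∀ v, f (F v) = F' (f v)) (N : ℕ) (v : X) :
    f ((∑ i ∈ range N, F ^ i) v) = (∑ i ∈ range N, F' ^ i) (f v) := by
  rw [LinearMap.sum_apply, LinearMap.sum_apply, map_sum]
  exact sum_congr rfl fun i _ => apply_pow_apply_eq_of_comm f h i v

/-- If `f ∘ F = F' ∘ f` then `f` carries the derivative operator `Σ_{i<N} i F^i` to
`Σ_{i<N} i F'^i`. [folklore] -/
theorem apply_deriv_apply_eq_of_comm (f : X →ₗ[A] Y) {F : Module.End A X} {F' : Module.End A Y}
    (h : ∀ v, f (F v) = F' (f v)) (N : ℕ) (v : X) :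
    f ((∑ i ∈ range N, (i : Module.End A X) * F ^ i) v) =
      (∑ i ∈ range N, (i : Module.End A Y) * F' ^ i) (f v) := by
  rw [LinearMap.sum_apply, LinearMap.sum_apply, map_sum]
  refine sum_congr rfl fun i _ => ?_
  rw [Module.End.mul_apply, Module.End.mul_apply, Module.End.natCast_apply,
    Module.End.natCast_apply, map_nsmul, apply_pow_apply_eq_of_comm f h i v]

/-- If `f ∘ F = F' ∘ f` then `f (P(F) v) = P(F') (f v)` for every polynomial `P`. [folklore] -/
theorem apply_aeval_apply_eq_of_comm (f : X →ₗ[A] Y) {F : Module.End A X} {F' : Module.End A Y}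
    (h : ∀ v, f (F v) = F' (f v)) (P : A[X]) (v : X) :
    f (aeval F P v) = aeval F' P (f v) := by
  rw [aeval_eq_sum_range, aeval_eq_sum_range, LinearMap.sum_apply, LinearMap.sum_apply, map_sum]
  refine sum_congr rfl fun i _ => ?_
  rw [LinearMap.smul_apply, LinearMap.smul_apply, map_smul, apply_pow_apply_eq_of_comm f h i v]

end Transport

/-! ### §2 Invariance of the derivative of an Euler family ([Rubin00] Lemma 4.4.2) -/

variable {ι : Type w} [DecidableEq ι]

/-- **The derivative of an Euler family is invariant** (Rubin, *Euler Systems*, Lemma 4.4.2, in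
abstract form).  Data: pairwise commuting `σ_ℓ ∈ End_A X`, integers `N_ℓ`, endomorphisms `F_ℓ`
commuting with the `σ`'s, polynomials `P_ℓ`, a product operator `Dr` with
`Dr (insert ℓ s) = D_ℓ * Dr s` (`D_ℓ = Σ_{i<N_ℓ} i σ_ℓ^i`) commuting with the `σ`'s and `F`'s, and a
family `x_s` (`s ⊆ r`).  Hypotheses (an EULER FAMILY killed by the `N_ℓ` and `P_ℓ(1)`):
`σ_ℓ x_s = x_s` for `ℓ ∈ r ∖ s`; `σ_ℓ^{N_ℓ} x_s = x_s`, and the norm relation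
`N_{σ_ℓ} x_s = P_ℓ(F_ℓ) x_{s∖ℓ}`, for `ℓ ∈ s`; `N_ℓ • X = 0 = P_ℓ(1) • X`; each `F_ℓ` fixes every
common fixed vector of the `σ_q`, `q ∈ r`.  Conclusion: `σ_q (D_s x_s) = D_s x_s` for all
`s ⊆ r`, `q ∈ r`.  Proof: Rubin's induction — for `q ∈ s`,
`(σ_q − 1) D_s x_s = D_{s∖q} (N_q − N_{σ_q}) x_s = −P_q(F_q) D_{s∖q} x_{s∖q} = −P_q(1) D_{s∖q} x_{s∖q} = 0`.
[cite: Rubin2000, Lemma 4.4.2] -/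
theorem apply_deriv_apply_eq_of_eulerFamily
    (σ F : ι → Module.End A X) (N : ι → ℕ) (P : ι → A[X]) (Dr : Finset ι → Module.End A X)
    (r : Finset ι) (x : Finset ι → X)
    (hDins : ∀ s ℓ, ℓ ∉ s →
      Dr (insert ℓ s) = (∑ i ∈ range (N ℓ), (i : Module.End A X) * σ ℓ ^ i) * Dr s)
    (hσD : ∀ a s, Commute (σ a) (Dr s)) (hFD : ∀ a s, Commute (F a) (Dr s))
    (hfix : ∀ s ⊆ r, ∀ ℓ ∈ r, ℓ ∉ s → σ ℓ (x s) = x s)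
    (hord : ∀ s ⊆ r, ∀ ℓ ∈ s, (σ ℓ ^ N ℓ) (x s) = x s)
    (hnorm : ∀ s ⊆ r, ∀ ℓ ∈ s, (∑ i ∈ range (N ℓ), σ ℓ ^ i) (x s) = aeval (F ℓ) (P ℓ) (x (s.erase ℓ)))
    (hN : ∀ ℓ ∈ r, ∀ y : X, (N ℓ : A) • y = 0) (hP : ∀ ℓ ∈ r, ∀ y : X, (P ℓ).eval 1 • y = 0)
    (hF : ∀ ℓ ∈ r, ∀ y : X, (∀ q ∈ r, σ q y = y) → F ℓ y = y) :
    ∀ s ⊆ r, ∀ q ∈ r, σ q (Dr s (x s)) = Dr s (x s) := by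
  -- strong induction on the cardinality of `s`
  suffices h : ∀ n : ℕ, ∀ s ⊆ r, s.card = n → ∀ q ∈ r, σ q (Dr s (x s)) = Dr s (x s) from
    fun s hs q hq => h s.card s hs rfl q hq
  intro n
  induction n using Nat.strong_induction_on with
  | _ n ih =>
  intro s hs hcard q hq
  by_cases hqs : q ∈ s
  · -- the interesting case: peel `q` off `s`
    set s' := s.erase q with hs'
    have hqs' : q ∉ s' := Finset.notMem_erase q s
    have hss : s = insert q s' := (Finset.insert_erase hqs).symm
    have hs's : s' ⊆ r := (Finset.erase_subset q s).trans hs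
    have hcard' : s'.card < n := by
      rw [← hcard, hs']
      exact Finset.card_erase_lt_of_mem hqs
    -- induction hypothesis: `Dr s' (x s')` is fixed by every `σ_a`, `a ∈ r`
    have IH : ∀ a ∈ r, σ a (Dr s' (x s')) = Dr s' (x s') :=
      fun a ha => ih s'.card hcard' s' hs's rfl a ha
    -- `z := Dr s' (x s)` satisfies `σ_q^{N_q} z = z`
    set z := Dr s' (x s) with hz
    have hzN : (σ q ^ N q) z = z := by
      rw [hz]
      exact apply_apply_eq_of_commute ((hσD q s').pow_left (N q)) (hord s hs q hqs)
    -- `Dr s (x s) = D_q z`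
    have hDs' : Dr s = (∑ i ∈ range (N q), (i : Module.End A X) * σ q ^ i) * Dr s' := by
      rw [hss]
      exact hDins s' q hqs'
    have hDs : Dr s (x s) = (∑ i ∈ range (N q), (i : Module.End A X) * σ q ^ i) z := by
      rw [hDs', Module.End.mul_apply]
    -- telescoping: `(σ_q - 1)(D_q z) = N_q • z - N_{σ_q} z`
    have htel := sub_one_deriv_apply_of_pow_apply_eq (σ q) (N q) z hzN
    -- the norm term: `N_{σ_q} z = Dr s' (N_{σ_q} x_s) = Dr s' (P_q(F_q) x_{s'}) = P_q(F_q) (Dr s' x_{s'})`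
    have hc₁ : Commute (Dr s') (∑ i ∈ range (N q), σ q ^ i) :=
      commute_norm_of_commute (hσD q s').symm (N q)
    have hc₂ : Commute (Dr s') (aeval (F q) (P q)) :=
      commute_aeval_of_commute (hFD q s').symm (P q)
    have hnormz : (∑ i ∈ range (N q), σ q ^ i) z = aeval (F q) (P q) (Dr s' (x s')) := by
      calc (∑ i ∈ range (N q), σ q ^ i) z
          = Dr s' ((∑ i ∈ range (N q), σ q ^ i) (x s)) := (apply_comm_of_commute hc₁ (x s)).symm
        _ = Dr s' (aeval (F q) (P q) (x s')) := by rw [hnorm s hs q hqs]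
        _ = aeval (F q) (P q) (Dr s' (x s')) := apply_comm_of_commute hc₂ (x s')
    -- `P_q(F_q)` acts on the invariant vector `Dr s' (x s')` as `P_q(1)`, which kills `X`
    have hkill : aeval (F q) (P q) (Dr s' (x s')) = 0 := by
      rw [aeval_apply_eq_eval_one_smul_of_apply_eq (F q) (P q) _ (hF q hq _ IH), hP q hq]
    have hzero : (σ q - 1) (Dr s (x s)) = 0 := by
      rw [hDs, htel, hnormz, hkill, hN q hq, sub_zero]
    rwa [LinearMap.sub_apply, Module.End.one_apply, sub_eq_zero] at hzero
  · -- `q ∉ s`: `σ_q` commutes with `Dr s` and fixes `x s`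
    exact apply_apply_eq_of_commute (hσD q s) (hfix s hs q hq hqs)

omit [DecidableEq ι] in
/-- The derivative operators pairwise commute when the `σ`'s do. [folklore] -/
theorem commute_deriv_deriv {σ : ι → Module.End A X} (hσσ : ∀ a b, Commute (σ a) (σ b))
    (N : ι → ℕ) (a b : ι) :
    Commute (∑ i ∈ range (N a), (i : Module.End A X) * σ a ^ i)
      (∑ i ∈ range (N b), (i : Module.End A X) * σ b ^ i) :=
  commute_deriv_of_commute (commute_deriv_of_commute (hσσ b a) (N a)).symm (N b)

/-- **Invariance of `D_r x_r` for `D_r = r.noncommProd D_•`** (the form consumed by the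
cohomological instantiation): under the Euler-family hypotheses of
`apply_deriv_apply_eq_of_eulerFamily`, with `Dr s := s.noncommProd (ℓ ↦ Σ_{i<N_ℓ} i σ_ℓ^i)`,
every `σ_q` (`q ∈ r`) fixes `D_r x_r`.  Ref: Rubin, *Euler Systems* (2000), Def. 4.4.1,
Lemma 4.4.2. [cite: Rubin2000, Lemma 4.4.2] -/
theorem apply_noncommProd_deriv_apply_eq_of_eulerFamily
    (σ F : ι → Module.End A X) (N : ι → ℕ) (P : ι → A[X]) (r : Finset ι) (x : Finset ι → X)
    (hσσ : ∀ a b, Commute (σ a) (σ b)) (hFσ : ∀ a b, Commute (F a) (σ b))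
    (hfix : ∀ s ⊆ r, ∀ ℓ ∈ r, ℓ ∉ s → σ ℓ (x s) = x s)
    (hord : ∀ s ⊆ r, ∀ ℓ ∈ s, (σ ℓ ^ N ℓ) (x s) = x s)
    (hnorm : ∀ s ⊆ r, ∀ ℓ ∈ s, (∑ i ∈ range (N ℓ), σ ℓ ^ i) (x s) = aeval (F ℓ) (P ℓ) (x (s.erase ℓ)))
    (hN : ∀ ℓ ∈ r, ∀ y : X, (N ℓ : A) • y = 0) (hP : ∀ ℓ ∈ r, ∀ y : X, (P ℓ).eval 1 • y = 0)
    (hF : ∀ ℓ ∈ r, ∀ y : X, (∀ q ∈ r, σ q y = y) → F ℓ y = y)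
    (s : Finset ι) (hs : s ⊆ r) (q : ι) (hq : q ∈ r) :
    σ q ((s.noncommProd (fun ℓ => ∑ i ∈ range (N ℓ), (i : Module.End A X) * σ ℓ ^ i)
        fun a _ b _ _ => commute_deriv_deriv hσσ N a b) (x s)) =
      (s.noncommProd (fun ℓ => ∑ i ∈ range (N ℓ), (i : Module.End A X) * σ ℓ ^ i)
        fun a _ b _ _ => commute_deriv_deriv hσσ N a b) (x s) := by
  refine apply_deriv_apply_eq_of_eulerFamily σ F N P
    (fun s => s.noncommProd (fun ℓ => ∑ i ∈ range (N ℓ), (i : Module.End A X) * σ ℓ ^ i)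
      fun a _ b _ _ => commute_deriv_deriv hσσ N a b)
    r x (fun s ℓ hℓ => ?_) (fun a s => ?_) (fun a s => ?_)
    hfix hord hnorm hN hP hF s hs q hq
  · exact Finset.noncommProd_insert_of_notMem s ℓ _ _ hℓ
  · exact Finset.noncommProd_commute _ _ _ _ fun b _ => commute_deriv_of_commute (hσσ a b) (N b)
  · exact Finset.noncommProd_commute _ _ _ _ fun b _ => commute_deriv_of_commute (hFσ a b) (N b)

end Module

end Derivative

end Summit.BirchSwinnertonDyer.Rank1Residual.GaloisImage

end
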